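import Summits.RiemannHypothesis.RiemannHypothesis.Theses.WeilComb
import Mathlib.NumberTheory.Harmonic.Bounds
import Mathlib.Algebra.Order.Chebyshev

/-!
# Stub `stub_polarCS` of line `Sketch` for crux `WeilComb.CombShapePositivity`
(item stmt-RiemannHypothesis-11229)

**Statement (pole shadow, Cauchy–Schwarz twice).** For `a : ℕ → ℂ` and `M : ℕ` put
`L = Σ_{m ≤ M} ‖a_m‖²`, `A₋ = Σ_{m ≤ M} ‖a_m‖/√m`, `A₊ = Σ_{m ≤ M} ‖a_m‖ √m`,
`X = Σ_{m ≤ M} m log m ‖a_m‖²`. Then `(A₋ A₊)² ≤ 4M · L · (M · L + X)`.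

**Why.** In the glue `window_of` of Theorem B (window `2ε(M+1) ≤ 1`) the rank-2 pole term of the
explicit formula for the comb is bounded below by `−2F_ε² A₋A₊`; this estimate, the multiscale
Poincaré inequality `X ≤ 2M·D + O(M·L)` and AM–GM absorb it into `U·D/2 + C·U·L`.

**Proof.** Cauchy–Schwarz twice: `A₋² ≤ L · H_M` with `H_M = Σ_{m ≤ M} 1/m ≤ 1 + log M`
(`harmonic_le_one_add_log`), and `A₊² ≤ (Σ m(1 + log m)‖a_m‖²)(Σ_{m ≤ M} 1/(1 + log m))` with
`Σ m(1 + log m)‖a_m‖² ≤ M·L + X`. Finally `(1 + log M) Σ_{m ≤ M} 1/(1 + log m) ≤ 4M`, from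
`(1 + log M)/(1 + log m) ≤ 2√(M/m)` (i.e. `log t ≤ t − 1` at `t = √(M/m)`) and `Σ_{m ≤ M} 1/√m ≤ 2√M`.
Adapted from the private theorem `polar_sq_le` of
`Theorems/WeilCombCombSubcriticalStubCore.lean` (same statement, other namespace).
-/

noncomputable section

-- the sub-problem path `RiemannHypothesis/RiemannHypothesis` (single-conjunct summit) duplicates a namespace
set_option linter.dupNamespace false

open scoped BigOperators ComplexConjugate
open Complex MeasureTheory Set

namespace Summit.RiemannHypothesis.RiemannHypothesis.Theorems.WeilCombBohrFejer

open Literature.NumberTheory.LFunctions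

-- adapted from Theorems/WeilCombCombSubcriticalStubCore.lean (`sum_one_div_le_log`, case `e = id`)
/-- The harmonic bound `Σ_{m ≤ M} 1/m ≤ 1 + log M` (Mathlib's `harmonic_le_one_add_log`). -/
private theorem sum_Icc_one_div_le_log_polarCS (M : ℕ) :
    ∑ m ∈ Finset.Icc 1 M, 1 / (m : ℝ) ≤ 1 + Real.log M := by
  have hH := harmonic_le_one_add_log M
  simp_rw [harmonic_eq_sum_Icc, Rat.cast_sum, Rat.cast_inv, Rat.cast_natCast] at hH
  simpa only [one_div] using hH

-- adapted from Theorems/WeilCombCombSubcriticalStubCore.lean (`sum_Icc_inv_sqrt_le`)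
/-- `Σ_{m ≤ M} 1/√m ≤ 2 √M`. -/
private theorem sum_Icc_inv_sqrt_le_polarCS (M : ℕ) :
    ∑ m ∈ Finset.Icc 1 M, (Real.sqrt m)⁻¹ ≤ 2 * Real.sqrt M := by
  induction M with
  | zero => simp
  | succ N ih =>
    rw [Finset.sum_Icc_succ_top (Nat.succ_le_succ (Nat.zero_le N))]
    push_cast
    have htpos : 0 < Real.sqrt ((N : ℝ) + 1) := Real.sqrt_pos.mpr (by positivity)
    have key : (Real.sqrt ((N : ℝ) + 1))⁻¹ ≤ 2 * Real.sqrt ((N : ℝ) + 1) - 2 * Real.sqrt N := by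
      rw [inv_eq_one_div, div_le_iff₀ htpos]
      nlinarith [sq_nonneg (Real.sqrt N - Real.sqrt ((N : ℝ) + 1)),
        Real.sq_sqrt (Nat.cast_nonneg (α := ℝ) N),
        Real.sq_sqrt (by positivity : (0 : ℝ) ≤ (N : ℝ) + 1)]
    linarith

-- adapted from Theorems/WeilCombCombSubcriticalStubCore.lean (`one_add_log_mul_sum_le`)
/-- `(1 + log M) · Σ_{m ≤ M} 1/(1 + log m) ≤ 4M`, from `(1 + log M)/(1 + log m) ≤ 2 √(M/m)`. -/
private theorem one_add_log_mul_sum_le_polarCS (M : ℕ) :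
    (1 + Real.log M) * ∑ m ∈ Finset.Icc 1 M, (1 + Real.log m)⁻¹ ≤ 4 * M := by
  have key : ∀ m ∈ Finset.Icc 1 M,
      (1 + Real.log M) * (1 + Real.log m)⁻¹ ≤ 2 * Real.sqrt M * (Real.sqrt m)⁻¹ := by
    intro m hm
    obtain ⟨hm, hmM⟩ := Finset.mem_Icc.mp hm
    have hm0 : (0 : ℝ) < m := by exact_mod_cast hm
    have hM0 : (0 : ℝ) < M := by exact_mod_cast hm.trans hmM
    have hlogm : 0 ≤ Real.log m := Real.log_natCast_nonneg m
    have hℓ : 0 < 1 + Real.log m := by linarith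
    have hu0 : 0 ≤ Real.log M - Real.log m :=
      sub_nonneg.mpr (Real.log_le_log hm0 (by exact_mod_cast hmM))
    have hr : 0 < (M : ℝ) / m := div_pos hM0 hm0
    have hu : Real.log M - Real.log m ≤ 2 * (Real.sqrt M * (Real.sqrt m)⁻¹) - 2 := by
      have h1 := Real.log_le_sub_one_of_pos (Real.sqrt_pos.mpr hr)
      rw [Real.log_sqrt hr.le, Real.log_div hM0.ne' hm0.ne', Real.sqrt_div hM0.le,
        div_eq_mul_inv (Real.sqrt M)] at h1
      linarith
    rw [← div_eq_mul_inv (1 + Real.log M), div_le_iff₀ hℓ]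
    nlinarith [mul_nonneg hlogm hu0, mul_le_mul_of_nonneg_left hu hℓ.le]
  rw [Finset.mul_sum]
  refine (Finset.sum_le_sum key).trans ?_
  rw [← Finset.mul_sum]
  nlinarith [mul_le_mul_of_nonneg_left (sum_Icc_inv_sqrt_le_polarCS M)
    (by positivity : (0 : ℝ) ≤ 2 * Real.sqrt M), Real.mul_self_sqrt (Nat.cast_nonneg (α := ℝ) M)]

-- adapted from Theorems/WeilCombCombSubcriticalStubCore.lean (`polar_sq_le`)
/-- **Stub B1 — pole shadow by Cauchy–Schwarz twice.** `(A₋ A₊)² ≤ 4M ‖a‖² (M ‖a‖² + Σ_m m log m ‖a_m‖²)`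
(`A₋² ≤ ‖a‖² H_M`, `A₊² ≤ (Σ m(1 + log m)‖a_m‖²)(Σ 1/(1 + log m))`, `H_M · Σ_{m ≤ M} 1/(1 + log m) ≤ 4M`). -/
theorem stub_polarCS : ∀ (M : ℕ) (a : ℕ → ℂ),
    ((∑ m ∈ Finset.Icc 1 M, ‖a m‖ / Real.sqrt m) *
        (∑ m ∈ Finset.Icc 1 M, ‖a m‖ * Real.sqrt m)) ^ 2 ≤
      4 * M * (∑ m ∈ Finset.Icc 1 M, ‖a m‖ ^ 2) *
        (M * (∑ m ∈ Finset.Icc 1 M, ‖a m‖ ^ 2) +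
          ∑ m ∈ Finset.Icc 1 M, (m : ℝ) * Real.log m * ‖a m‖ ^ 2) := by
  intro M a
  have hℓ : ∀ m : ℕ, 0 < 1 + Real.log m := fun m => by positivity
  -- Cauchy–Schwarz for `A₋`
  have hAm : (∑ m ∈ Finset.Icc 1 M, ‖a m‖ / Real.sqrt m) ^ 2 ≤
      (∑ m ∈ Finset.Icc 1 M, ‖a m‖ ^ 2) * ∑ m ∈ Finset.Icc 1 M, 1 / (m : ℝ) := by
    calc (∑ m ∈ Finset.Icc 1 M, ‖a m‖ / Real.sqrt m) ^ 2
        = (∑ m ∈ Finset.Icc 1 M, ‖a m‖ * (Real.sqrt m)⁻¹) ^ 2 := by simp_rw [div_eq_mul_inv]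
      _ ≤ (∑ m ∈ Finset.Icc 1 M, ‖a m‖ ^ 2) * ∑ m ∈ Finset.Icc 1 M, ((Real.sqrt m)⁻¹) ^ 2 :=
          Finset.sum_mul_sq_le_sq_mul_sq _ _ _
      _ = (∑ m ∈ Finset.Icc 1 M, ‖a m‖ ^ 2) * ∑ m ∈ Finset.Icc 1 M, 1 / (m : ℝ) := by
          congr 1
          refine Finset.sum_congr rfl fun m _ => ?_
          rw [inv_pow, Real.sq_sqrt (Nat.cast_nonneg _), one_div]
  -- Cauchy–Schwarz for `A₊`
  have hAp : (∑ m ∈ Finset.Icc 1 M, ‖a m‖ * Real.sqrt m) ^ 2 ≤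
      (∑ m ∈ Finset.Icc 1 M, (m : ℝ) * (1 + Real.log m) * ‖a m‖ ^ 2) *
        ∑ m ∈ Finset.Icc 1 M, (1 + Real.log m)⁻¹ := by
    calc (∑ m ∈ Finset.Icc 1 M, ‖a m‖ * Real.sqrt m) ^ 2
        = (∑ m ∈ Finset.Icc 1 M, (‖a m‖ * Real.sqrt m * Real.sqrt (1 + Real.log m)) *
            (Real.sqrt (1 + Real.log m))⁻¹) ^ 2 := by
          congr 1
          refine Finset.sum_congr rfl fun m _ => ?_
          rw [mul_inv_cancel_right₀ (Real.sqrt_pos.mpr (hℓ m)).ne']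
      _ ≤ (∑ m ∈ Finset.Icc 1 M, (‖a m‖ * Real.sqrt m * Real.sqrt (1 + Real.log m)) ^ 2) *
            ∑ m ∈ Finset.Icc 1 M, ((Real.sqrt (1 + Real.log m))⁻¹) ^ 2 :=
          Finset.sum_mul_sq_le_sq_mul_sq _ _ _
      _ = (∑ m ∈ Finset.Icc 1 M, (m : ℝ) * (1 + Real.log m) * ‖a m‖ ^ 2) *
            ∑ m ∈ Finset.Icc 1 M, (1 + Real.log m)⁻¹ := by
          congr 1
          · refine Finset.sum_congr rfl fun m _ => ?_
            rw [mul_pow, mul_pow, Real.sq_sqrt (Nat.cast_nonneg _), Real.sq_sqrt (hℓ m).le]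
            ring
          · refine Finset.sum_congr rfl fun m _ => ?_
            rw [inv_pow, Real.sq_sqrt (hℓ m).le]
  -- `X' = Σ m(1 + log m)‖a_m‖² ≤ M ‖a‖² + Σ m log m ‖a_m‖²`
  have hX : ∑ m ∈ Finset.Icc 1 M, (m : ℝ) * (1 + Real.log m) * ‖a m‖ ^ 2 ≤
      M * (∑ m ∈ Finset.Icc 1 M, ‖a m‖ ^ 2) +
        ∑ m ∈ Finset.Icc 1 M, (m : ℝ) * Real.log m * ‖a m‖ ^ 2 := by
    rw [Finset.mul_sum, ← Finset.sum_add_distrib]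
    refine Finset.sum_le_sum fun m hm => ?_
    have h : (m : ℝ) ≤ M := by exact_mod_cast (Finset.mem_Icc.mp hm).2
    nlinarith [mul_le_mul_of_nonneg_right h (sq_nonneg ‖a m‖)]
  have hH : ∑ m ∈ Finset.Icc 1 M, 1 / (m : ℝ) ≤ 1 + Real.log M := sum_Icc_one_div_le_log_polarCS M
  have hG := one_add_log_mul_sum_le_polarCS M
  have hL0 : 0 ≤ ∑ m ∈ Finset.Icc 1 M, ‖a m‖ ^ 2 := by positivity
  have hX0 : 0 ≤ ∑ m ∈ Finset.Icc 1 M, (m : ℝ) * (1 + Real.log m) * ‖a m‖ ^ 2 := by positivity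
  have hG0 : 0 ≤ ∑ m ∈ Finset.Icc 1 M, (1 + Real.log (m : ℝ))⁻¹ := by positivity
  have hH0 : 0 ≤ ∑ m ∈ Finset.Icc 1 M, 1 / (m : ℝ) := by positivity
  set L := ∑ m ∈ Finset.Icc 1 M, ‖a m‖ ^ 2
  set X := ∑ m ∈ Finset.Icc 1 M, (m : ℝ) * (1 + Real.log m) * ‖a m‖ ^ 2
  set G := ∑ m ∈ Finset.Icc 1 M, (1 + Real.log (m : ℝ))⁻¹
  set HM := ∑ m ∈ Finset.Icc 1 M, 1 / (m : ℝ)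
  rw [mul_pow]
  calc _ ≤ (L * HM) * (X * G) := mul_le_mul hAm hAp (sq_nonneg _) (mul_nonneg hL0 hH0)
    _ = L * X * (HM * G) := by ring
    _ ≤ L * X * ((1 + Real.log M) * G) :=
        mul_le_mul_of_nonneg_left (mul_le_mul_of_nonneg_right hH hG0) (mul_nonneg hL0 hX0)
    _ ≤ L * X * (4 * M) := mul_le_mul_of_nonneg_left hG (mul_nonneg hL0 hX0)
    _ = 4 * M * L * X := by ring
    _ ≤ _ := mul_le_mul_of_nonneg_left hX (by positivity)

end Summit.RiemannHypothesis.RiemannHypothesis.Theorems.WeilCombBohrFejer
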